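import Summits.AtomisticToContinuum.HydrodynamicLimit.Theses.RingDensityCertificate
import Summits.AtomisticToContinuum.HydrodynamicLimit.Theses.InformationPercolationEngine
import Summits.AtomisticToContinuum.HydrodynamicLimit.Theses.TwoClocks
import Summits.AtomisticToContinuum.HydrodynamicLimit.Theses.LimitCollisionMeasure
import Summits.AtomisticToContinuum.HydrodynamicLimit.Theorems.InformationPercolationEngineChaosClosesEulerReadout
import Summits.AtomisticToContinuum.HydrodynamicLimit.Theorems.InformationPercolationEngineChaosClosesEulerCollisionMomentUI
import Summits.AtomisticToContinuum.HydrodynamicLimit.Theorems.InformationPercolationEngineChaosClosesEulerEnskogIdentity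
import HarnessLib
import HarnessLib.Audit

/-!
# Line `birth` — BIRTH SKELETON of crux `RingDensityCertificate.ChaosClosure` (stmt-AtomisticToContinuum-12129)

Route `route-AtomisticToContinuum-RingDensityCertificate` (sub-problem `HydrodynamicLimit`), crux #5:
`ChaosClosure : ContactChaos → ⟨packing-guarded hard-sphere Euler limit⟩` — EMPIRICAL ENSKOG CHAOS CLOSES hs-EULER IN THE
PACKING BAND.  The antecedent `ContactChaos` (stmt-12125, this route's typed target) is the cell × kinetic-window EMPIRICAL
STOSSZAHLANSATZ along the flow: (SEL+ANG) collision-sampled statistics of `(v⁻, v*⁻, ω)` equal the flux-biased all-pairs law of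
the cell, (RATE) the collision count equals the Enskog prediction with contact factor `g_E(n_cell σ³)`.  The consequent is
VERBATIM the re-typed Statement `_root_.HydrodynamicLimit` (D-0032) — and verbatim the conclusion of the neighbouring crux
`InformationPercolationEngine.ChaosClosesEuler` (stmt-15141), typed below as `HydroLimitInBandConclusion`
(`chaosClosure_iff : ChaosClosure ↔ (ContactChaos → HydroLimitInBandConclusion)` is `Iff.rfl`).

THE LINE (the route's recorded two-layer plan `ChaosClosure ⇐ EmpiricalHTheorem → FluxAndEntropyClosure → weak–strong
uniqueness`, typed with the waypoints and the lessons of the neighbouring line `Cruxes/ChaosClosesEuler/Lines/Sketch.lean`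
v9, whose typed waypoints `CollisionMomentUI`, `WeakStressIsotropyInBand`, `CollisionalPressureValueInBand`,
`MollifiedCloseTimeAveraged`, `HydroLimitInBandConclusion` are copied VERBATIM in §1 so that its LANDED theorems apply by `rfl`):

* KINETIC HALF (this crux's own content, the "EmpiricalHTheorem"): from cell/window Enskog chaos, Bogolyubov's exact empirical
  identity and an H-theorem at the empirical level, the cell velocity laws Maxwellianise within `O(1)` kinetic units, so
  (`stub_cellMaxwellianisation`) the full local pressure tensor is weakly ISOTROPIC in band and the collisional momentum
  transfer takes the hard-sphere PRESSURE VALUE `p_hs − ρθ = ρθ(Z(ρσ³) − 1)` (the RATE clause carries exactly the Enskog contact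
  factor `g_E = (Z − 1)/((2π/3)η)`); (`stub_rateTransfer`) the RATE clause, stated on mesoscopic cells and kinetic windows as a
  ratio, transfers to the cone-mollified, space–time-tested in-band collision-rate identification
  `InformationPercolationEngine.CollisionRate` (stmt-13481) that the landed readout consumes; (`stub_entropyProduction`) the
  Résibois H-theorem for the empirical REVISED-Enskog structure (contact factor at the local empirical density) gives
  non-negative entropy production INCLUDING the configurational part `−ρ f_ex(ρσ³)`, i.e. the clamped local second law
  `LimitCollisionMeasure.LocalSecondLaw` (stmt-13352) in the renormalised format BF18 consumes.
* PDE HALF (`stub_relativeEnergyStability`, shared in substance with the neighbouring line's open `stub_kineticReduction` fed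
  with its LANDED deterministic shell `Theorems.ChaosClosesEulerBF18Shell.stub_bf18Shell`): the pathwise Březina–Feireisl
  relative-energy Grönwall of the cone-mollified empirical fields against the classical solution, fed by the in-band flux
  closures, the clamped entropy inequality, the fine-scale density cap and the quadratic-mark UI, outputs TIME-AVERAGED `L¹`
  closeness (`MollifiedCloseTimeAveraged`) — not closeness at the instant (neighbour NOTES §B5) —, and the LANDED weak readout
  `Theorems.ChaosClosesEulerReadout.stub_readout` (p119530) returns the crux's conclusion at every `t ∈ [0, T)`.
* EXTERNAL INPUTS, verbatim open items of the board, never claimed from bounded-mark chaos (the velocity-tail gap that sank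
  the dock KineticClosure stmt-13482 under four prover verdicts): `stub_velocityTails` = `TwoClocks.EnergyCurrentTails`
  (stmt-9235, cubic one-body tails) ∧ `LimitCollisionMeasure.CollisionTightness` (stmt-13354, quartic moment tightness of the
  collision measure; gives `CollisionMomentUI` by the LANDED `Theorems.ChaosClosesEulerCollisionMomentUI.stub_collisionMomentUI`,
  p110597); `stub_densityCap` = `InformationPercolationEngine.DensityCap` (stmt-13082, no fine-scale over-compression before
  the shock; neighbour NOTES §B4: not derivable with tolerances fixed before `r`).

REGISTERED STUBS (6; statements are the named Props of §2, mirrored by the aliases `__Registered.stub_<name>` of §2b so that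
`ChaosClosure_of` takes them BY STUB NAME — the `@[stub]` tag being gate-reserved, this is the device of the sibling birth skeletons
`Cruxes/FastCollisionThroughput/Lines/birth.lean`, `Cruxes/MaxSpeedBoundPreShock/Lines/birth.lean`):
* `stub_velocityTails`          : `VelocityTails`          = 9235 ∧ 13354                                   [external, open ×2]
* `stub_densityCap`             : `FineScaleDensityCap`    = 13082                                           [external, open, L]
* `stub_cellMaxwellianisation`  : `CellMaxwellianisation`  = CC → ECT → UI → WSI ∧ CPV                       [own, XL — HARDEST]
* `stub_rateTransfer`           : `RateTransfer`           = CC → ECT → CT → IPE.CollisionRate               [own, M–L]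
* `stub_entropyProduction`      : `EntropyProduction`      = CC → ECT → CT → LCM.LocalSecondLaw (13352)     [own, XL / Boltzmann-hypothesis class]
* `stub_relativeEnergyStability`: `RelativeEnergyStability`= WSI → CPV → UI → IPE.CollisionRate → LCM.LocalSecondLaw → IPE.DensityCap → MCTA  [shared-open, XL−]
(CC = this route's `ContactChaos`, ECT = `TwoClocks.EnergyCurrentTails`, CT = `LimitCollisionMeasure.CollisionTightness`,
UI = `CollisionMomentUI`, WSI/CPV = the in-band flux closures, MCTA = `MollifiedCloseTimeAveraged`.)

ASSEMBLY `ChaosClosure_of : __Registered.stub_velocityTails → __Registered.stub_densityCap → __Registered.stub_cellMaxwellianisation →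
__Registered.stub_rateTransfer → __Registered.stub_entropyProduction → __Registered.stub_relativeEnergyStability → ChaosClosure` (the aliases
unfold reducibly to VelocityTails, FineScaleDensityCap, CellMaxwellianisation, RateTransfer, EntropyProduction, RelativeEnergyStability) is
PROVED (no `sorry`): UI from tightness (landed), flux closures / rate / entropy from
the kinetic stubs at the given `ContactChaos`, the Grönwall stub, then the landed readout with the landed Enskog identity
`Theorems.ChaosClosesEulerEnskogIdentity.stub_empiricalEnskogIdentity`.  The `example` after it wires the six sorried stubs in.

NEGATIVES / DISPROOF USED.  `Cruxes/ChaosClosure/` had no Disproof.lean at registration (crux dir empty, 2026-08-17).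
Negatives index (20 refuted statements) read: 9168 (untied, unguarded Euler frame) — every Euler-facing waypoint keeps the
`t = 0` tie `TendstoHydroFieldsAt … 0` and the guard `ρσ³ < η₀` verbatim; 9236/9238/6610/6612 (`r` before `N` orderings,
cold-cell claims) — every waypoint is `∃ r₀ ∀ r < r₀ ∃ N₀ ∀ N ≥ N₀` and no cold-cell negligibility is claimed; 13733
(equilibrium clamped collisional window LD) and 9218 (contact-intensity domination) are not restated.  The dropped dock 13482
(velocity-tail gap) is honoured: both tail channels are the explicit external stub `stub_velocityTails`.

BC3 (birth certificate, planner-skel-stmt-AtomisticToContinuum-12129-0, 2026-08-17): `lean check --json` rc 0 (farm, 9 s), sorries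
= 6 = the six `stub_*` (lines of §3) and nothing else; `#print axioms ChaosClosure_of` = [propext, Classical.choice, Quot.sound].
PROBES (seat folder `bc/probe1…3.lean`, same imports + waypoints; 36 examples, ALL FAIL as required): for each of the six stub
statements `S` and each target `X ∈ {ChaosClosure, _root_.HydrodynamicLimit}` — (a) `example : S → X := by first | exact? | simpa |
aesop` ⇒ error `unsolved goals … ⊢ X` (exact? and simpa fail, aesop "failed to prove the goal after exhaustive search"), 12/12;
(b) `unfold X; aesop` ⇒ deterministic timeout at `whnf`/`isDefEq` (400000 heartbeats), 12/12; (c) `simpa [X, waypoints]` ⇒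
`Tactic 'assumption' failed` (velocityTails, densityCap, rateTransfer, entropyProduction) or timeout (cellMaxwellianisation,
relativeEnergyStability), 12/12.  No stub is cheaply the crux or the summit.  Details: `Lines/birth.md`.
-/

noncomputable section

namespace Summit.AtomisticToContinuum.HydrodynamicLimit.Cruxes.ChaosClosure.Birth

open scoped BigOperators Topology Classical MeasureTheory ENNReal InnerProductSpace
open Filter Set MeasureTheory
open Literature.MathematicalPhysics.KineticTheory
open Literature.Analysis.FluidPDE
open Summit.AtomisticToContinuum.HydrodynamicLimit.Theses
open Summit.AtomisticToContinuum.HydrodynamicLimit.Theses.RingDensityCertificate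

/-! ## §1 Typed waypoints (VERBATIM copies of the neighbouring line's registered waypoints, `Cruxes/ChaosClosesEuler/Lines/Sketch.lean` v9) -/

/-- **Uniform integrability of the quadratic collision mark** (verbatim `ChaosClosesEuler.Sketch.CollisionMomentUI`; frame of
`InformationPercolationEngine.CollisionMomentBound`, stmt-15144): for every `η, δ` there is a level `L` beyond which the part
of `K_N[1+|vᵢ|²+|vⱼ|²]` carried by collisions with `|vᵢ|²+|vⱼ|² > L` is `≤ η` with probability `≥ 1 − δ`, eventually in `N`.
Follows from `LimitCollisionMeasure.CollisionTightness` (13354) by Chebyshev — LANDED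
(`Theorems.ChaosClosesEulerCollisionMomentUI.stub_collisionMomentUI`, p110597). -/
def CollisionMomentUI : Prop :=
  ∀ (a₀ θ₀ : T3 → ℝ) (u₀ : T3 → V3), Continuous a₀ → Continuous θ₀ → Continuous u₀ →
    (∀ x, 0 < a₀ x) → (∀ x, 0 < θ₀ x) → ∃ σ₀ : ℝ, 0 < σ₀ ∧ ∀ σ : ℝ, 0 < σ → σ < σ₀ →
    ∀ Φ : (N : ℕ) → HardSphereFlow (Torus.geometry (Fin 3)) (hsDiameter σ N) (N + 1),
    ∀ τ : ℝ, 0 < τ → ∀ η δ : ℝ, 0 < η → 0 < δ → ∃ L : ℝ, ∃ N₀ : ℕ, ∀ N : ℕ, N₀ ≤ N →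
    let ε := hsDiameter σ N
    let G : Geometry (Fin 3) T3 := Torus.geometry (Fin 3)
    let γ : Config (N + 1) (Fin 3) T3 → ℝ → Config (N + 1) (Fin 3) T3 := fun z s => (Φ N).flow s z
    let Kc : (Config (N + 1) (Fin 3) T3 → ℝ → Fin (N + 1) → Fin (N + 1) → ℝ) → Config (N + 1) (Fin 3) T3 → ℝ := fun F z =>
      ε / (N + 1 : ℝ) * ∑ᶠ (s : ℝ) (_ : s ∈ collisionTimes G ε (γ z) ∩ Set.Icc 0 τ),
        ∑ i : Fin (N + 1), ∑ j : Fin (N + 1),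
          (if i ≠ j ∧ ‖G.sepVec (γ z s i).1 (γ z s j).1‖ = ε then F z s i j else 0)
    localGibbsLaw σ a₀ u₀ θ₀ N (Φ N)
        {z | η < Kc (fun z s i j => if L < ‖(γ z s i).2‖ ^ 2 + ‖(γ z s j).2‖ ^ 2 then
          1 + ‖(γ z s i).2‖ ^ 2 + ‖(γ z s j).2‖ ^ 2 else 0) z} ≤ ENNReal.ofReal δ

/-- **Weak isotropy of the local pressure tensor, in band, pre-shock** (verbatim `ChaosClosesEuler.Sketch.WeakStressIsotropyInBand`):
in the Euler-tied frame, for every continuous TRACELESS tensor test field `a(s,x)` and every continuous density cut-off `g`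
vanishing on `[η₀, ∞)`, the space–time integral of `g(σ³ρ_r)·a : P_r` (`P_r` the full cone-mollified second central moment
tensor) tends to `0` in probability (`N → ∞` then `r → 0`).  HERE it is the output of CELL MAXWELLIANISATION from the route's
cell/window Enskog chaos (`stub_cellMaxwellianisation`). -/
def WeakStressIsotropyInBand : Prop :=
  ∃ η₀ : ℝ, 0 < η₀ ∧ ∀ (a₀ θ₀ : T3 → ℝ) (u₀ : T3 → V3), Continuous a₀ → Continuous θ₀ → Continuous u₀ →
    (∀ x, 0 < a₀ x) → (∀ x, 0 < θ₀ x) → ∃ σ₀ : ℝ, 0 < σ₀ ∧ ∀ σ : ℝ, 0 < σ → σ < σ₀ →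
    ∀ (T : ℝ) (ρ θ : ℝ → T3 → ℝ) (u : ℝ → T3 → V3), IsHardSphereEulerSolution σ T ρ u θ →
    ∀ Φ : (N : ℕ) → HardSphereFlow (Torus.geometry (Fin 3)) (hsDiameter σ N) (N + 1),
    TendstoHydroFieldsAt (fun N => localGibbsLaw σ a₀ u₀ θ₀ N (Φ N)) Φ ρ u θ 0 →
    ∀ t ∈ Set.Ico 0 T, ∀ a : Fin 3 → Fin 3 → ℝ × T3 → ℝ, (∀ j k, Continuous (a j k)) →
    (∀ p, ∑ j : Fin 3, a j j p = 0) →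
    ∀ g : ℝ → ℝ, Continuous g → (∀ b, η₀ ≤ b → g b = 0) →
    ∀ η δ : ℝ, 0 < η → 0 < δ → ∃ r₀ : ℝ, 0 < r₀ ∧ ∀ r : ℝ, 0 < r → r < r₀ → ∃ N₀ : ℕ, ∀ N : ℕ, N₀ ≤ N →
    let bx : T3 → T3 → ℝ := fun y x => 3 / (Real.pi * r ^ 3) * max (1 - Torus.euclidDist y x / r) 0
    let ρm : Config (N + 1) (Fin 3) T3 → T3 → ℝ := fun w x₀ => ∫ q, bx q.1 x₀ ∂(empiricalMeasure w)
    let mm : Config (N + 1) (Fin 3) T3 → T3 → V3 := fun w x₀ => ∫ q, bx q.1 x₀ • q.2 ∂(empiricalMeasure w)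
    let Pm : Config (N + 1) (Fin 3) T3 → T3 → Fin 3 → Fin 3 → ℝ := fun w x₀ j k =>
      (∫ q, bx q.1 x₀ * (q.2 j * q.2 k) ∂(empiricalMeasure w)) - mm w x₀ j * mm w x₀ k / ρm w x₀
    localGibbsLaw σ a₀ u₀ θ₀ N (Φ N)
      {z | η < |∫ s in Set.Icc 0 t, ∫ x, g (σ ^ 3 * ρm ((Φ N).flow s z) x) *
        ∑ j : Fin 3, ∑ k : Fin 3, a j k (s, x) * Pm ((Φ N).flow s z) x j k|} ≤ ENNReal.ofReal δ

/-- **Collisional pressure value, in band, pre-shock** (verbatim `ChaosClosesEuler.Sketch.CollisionalPressureValueInBand`): for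
every continuous symmetric tensor test field `a(s,x)` and continuous cut-off `g` vanishing on `[η₀,∞)`, the normalised collision
functional of the stress mark `g(σ³ρ_r(xᵢ))·|(vᵢ⁻−vⱼ⁻)·ω|·(ω⊗ω : a(s,xᵢ))` minus `2∫₀ᵗ∫ g(σ³ρ_r)(p_hs(ρ_r,θ_r) − ρ_rθ_r) tr a`
tends to `0` in probability.  HERE: SEL+ANG give the angular/partner law of the truncated mark, RATE gives the Enskog rate with
contact factor `g_E(n σ³) = (Z − 1)/((2π/3)η)` so that `(2π/3)ρ²σ³θ g_E = ρθ(Z − 1) = p_hs − ρθ`, WSI the isotropic value,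
`CollisionMomentUI` the remainder beyond truncation. -/
def CollisionalPressureValueInBand : Prop :=
  ∃ η₀ : ℝ, 0 < η₀ ∧ ∀ (a₀ θ₀ : T3 → ℝ) (u₀ : T3 → V3), Continuous a₀ → Continuous θ₀ → Continuous u₀ →
    (∀ x, 0 < a₀ x) → (∀ x, 0 < θ₀ x) → ∃ σ₀ : ℝ, 0 < σ₀ ∧ ∀ σ : ℝ, 0 < σ → σ < σ₀ →
    ∀ (T : ℝ) (ρ θ : ℝ → T3 → ℝ) (u : ℝ → T3 → V3), IsHardSphereEulerSolution σ T ρ u θ →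
    ∀ Φ : (N : ℕ) → HardSphereFlow (Torus.geometry (Fin 3)) (hsDiameter σ N) (N + 1),
    TendstoHydroFieldsAt (fun N => localGibbsLaw σ a₀ u₀ θ₀ N (Φ N)) Φ ρ u θ 0 →
    ∀ t ∈ Set.Ico 0 T, ∀ a : Fin 3 → Fin 3 → ℝ × T3 → ℝ, (∀ j k, Continuous (a j k)) →
    (∀ j k p, a j k p = a k j p) →
    ∀ g : ℝ → ℝ, Continuous g → (∀ b, η₀ ≤ b → g b = 0) →
    ∀ η δ : ℝ, 0 < η → 0 < δ → ∃ r₀ : ℝ, 0 < r₀ ∧ ∀ r : ℝ, 0 < r → r < r₀ → ∃ N₀ : ℕ, ∀ N : ℕ, N₀ ≤ N →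
    let ε := hsDiameter σ N
    let G : Geometry (Fin 3) T3 := Torus.geometry (Fin 3)
    let γ : Config (N + 1) (Fin 3) T3 → ℝ → Config (N + 1) (Fin 3) T3 := fun z s => (Φ N).flow s z
    let bx : T3 → T3 → ℝ := fun y x => 3 / (Real.pi * r ^ 3) * max (1 - Torus.euclidDist y x / r) 0
    let ρm : Config (N + 1) (Fin 3) T3 → T3 → ℝ := fun w x₀ => ∫ q, bx q.1 x₀ ∂(empiricalMeasure w)
    let mm : Config (N + 1) (Fin 3) T3 → T3 → V3 := fun w x₀ => ∫ q, bx q.1 x₀ • q.2 ∂(empiricalMeasure w)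
    let em : Config (N + 1) (Fin 3) T3 → T3 → ℝ := fun w x₀ =>
      ∫ q, bx q.1 x₀ * (‖q.2‖ ^ 2 / 2) ∂(empiricalMeasure w)
    let θm : Config (N + 1) (Fin 3) T3 → T3 → ℝ := fun w x₀ =>
      2 / 3 * (em w x₀ / ρm w x₀ - ‖mm w x₀‖ ^ 2 / (2 * ρm w x₀ ^ 2))
    let pv : Config (N + 1) (Fin 3) T3 → ℝ → Fin (N + 1) → Fin (N + 1) → V3 × V3 := fun z s i j =>
      reflectVel (G.sepVec (γ z s i).1 (γ z s j).1) ((γ z s i).2, (γ z s j).2)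
    let Kc : (Config (N + 1) (Fin 3) T3 → ℝ → Fin (N + 1) → Fin (N + 1) → ℝ) → Config (N + 1) (Fin 3) T3 → ℝ := fun F z =>
      ε / (N + 1 : ℝ) * ∑ᶠ (s : ℝ) (_ : s ∈ collisionTimes G ε (γ z) ∩ Set.Icc 0 t),
        ∑ i : Fin (N + 1), ∑ j : Fin (N + 1),
          (if i ≠ j ∧ ‖G.sepVec (γ z s i).1 (γ z s j).1‖ = ε then F z s i j else 0)
    let D : Config (N + 1) (Fin 3) T3 → ℝ := fun z =>
      Kc (fun z s i j =>
          g (σ ^ 3 * ρm (γ z s) (γ z s i).1) *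
            |⟪(pv z s i j).1 - (pv z s i j).2, ε⁻¹ • G.sepVec (γ z s i).1 (γ z s j).1⟫_ℝ| *
            ∑ k : Fin 3, ∑ l : Fin 3, a k l (s, (γ z s i).1) *
              ((ε⁻¹ • G.sepVec (γ z s i).1 (γ z s j).1) k * (ε⁻¹ • G.sepVec (γ z s i).1 (γ z s j).1) l)) z
        - 2 * ∫ s in Set.Icc 0 t, ∫ x, g (σ ^ 3 * ρm (γ z s) x) *
            (hsPressure σ (ρm (γ z s) x) (θm (γ z s) x) - ρm (γ z s) x * θm (γ z s) x) *
            ∑ k : Fin 3, a k k (s, x)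
    localGibbsLaw σ a₀ u₀ θ₀ N (Φ N) {z | η < |D z|} ≤ ENNReal.ofReal δ

/-- **Mollified fields close in TIME AVERAGE** (verbatim `ChaosClosesEuler.Sketch.MollifiedCloseTimeAveraged`): the frame of the
crux's conclusion with the `χ`-tested convergence at `t` replaced by TIME-AVERAGED `L¹(dx)` closeness in probability of the three
cone-mollified empirical fields to `(ρ, ρu, E)` over `[t, t+Δ] ⊆ [0,T)` for any fixed `Δ > 0` — the honest output of a
relative-energy Grönwall fed by in-probability inputs with fixed test functions (neighbour NOTES §B5); the first antecedent of
the LANDED readout `Theorems.ChaosClosesEulerReadout.stub_readout`. -/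
def MollifiedCloseTimeAveraged : Prop :=
  ∃ η₀ : ℝ, 0 < η₀ ∧ ∀ (a₀ θ₀ : T3 → ℝ) (u₀ : T3 → V3), Continuous a₀ → Continuous θ₀ → Continuous u₀ →
    (∀ x, 0 < a₀ x) → (∀ x, 0 < θ₀ x) → ∃ σ₀ : ℝ, 0 < σ₀ ∧ ∀ σ : ℝ, 0 < σ → σ < σ₀ →
    ∀ (T : ℝ) (ρ θ : ℝ → T3 → ℝ) (u : ℝ → T3 → V3), IsHardSphereEulerSolution σ T ρ u θ →
    (∀ t ∈ Set.Ico 0 T, ∀ x, ρ t x * σ ^ 3 < η₀) →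
    ∀ Φ : (N : ℕ) → HardSphereFlow (Torus.geometry (Fin 3)) (hsDiameter σ N) (N + 1),
    TendstoHydroFieldsAt (fun N => localGibbsLaw σ a₀ u₀ θ₀ N (Φ N)) Φ ρ u θ 0 →
    ∀ t ∈ Set.Ico 0 T, ∀ Δ : ℝ, 0 < Δ → t + Δ < T → ∀ η δ : ℝ, 0 < η → 0 < δ →
    ∃ r₀ : ℝ, 0 < r₀ ∧ ∀ r : ℝ, 0 < r → r < r₀ → ∃ N₀ : ℕ, ∀ N : ℕ, N₀ ≤ N →
    let bx : T3 → T3 → ℝ := fun y x => 3 / (Real.pi * r ^ 3) * max (1 - Torus.euclidDist y x / r) 0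
    localGibbsLaw σ a₀ u₀ θ₀ N (Φ N)
        {z | η * Δ < ∫ s in Set.Icc t (t + Δ),
          ((∫ x, |empiricalDensityField ((Φ N).flow s z) (fun y => bx y x) - ρ s x|)
          + (∫ x, ‖empiricalMomentumField ((Φ N).flow s z) (fun y => bx y x) - ρ s x • u s x‖)
          + ∫ x, |empiricalEnergyField ((Φ N).flow s z) (fun y => bx y x) -
              totalEnergyDensity (ρ s x) (u s x) (θ s x)|)} ≤ ENNReal.ofReal δ

/-- **The crux's conclusion** — VERBATIM the packing-guarded conjunct (= `_root_.HydrodynamicLimit` since the re-type D-0032,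
= the conclusion of `InformationPercolationEngine.ChaosClosesEuler`, = `ChaosClosesEuler.Sketch.HydroLimitInBandConclusion`). -/
def HydroLimitInBandConclusion : Prop :=
  ∃ η₀ : ℝ, 0 < η₀ ∧ ∀ (a₀ θ₀ : T3 → ℝ) (u₀ : T3 → V3), Continuous a₀ → Continuous θ₀ → Continuous u₀ →
    (∀ x, 0 < a₀ x) → (∀ x, 0 < θ₀ x) → ∃ σ₀ : ℝ, 0 < σ₀ ∧ ∀ σ : ℝ, 0 < σ → σ < σ₀ →
    ∀ (T : ℝ) (ρ θ : ℝ → T3 → ℝ) (u : ℝ → T3 → V3), IsHardSphereEulerSolution σ T ρ u θ →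
    (∀ t ∈ Set.Ico 0 T, ∀ x, ρ t x * σ ^ 3 < η₀) →
    ∀ Φ : (N : ℕ) → HardSphereFlow (Torus.geometry (Fin 3)) (hsDiameter σ N) (N + 1),
    TendstoHydroFieldsAt (fun N => localGibbsLaw σ a₀ u₀ θ₀ N (Φ N)) Φ ρ u θ 0 →
    ∀ t ∈ Set.Ico 0 T, TendstoHydroFieldsAt (fun N => localGibbsLaw σ a₀ u₀ θ₀ N (Φ N)) Φ ρ u θ t

/-- The crux is its antecedent implying `HydroLimitInBandConclusion` (by `Iff.rfl`). -/
theorem chaosClosure_iff : ChaosClosure ↔ (ContactChaos → HydroLimitInBandConclusion) :=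
  Iff.rfl

/-- The crux's conclusion is literally the re-typed sub-problem Statement (by `Iff.rfl`). -/
theorem hydroLimitInBandConclusion_iff_statement : HydroLimitInBandConclusion ↔ _root_.HydrodynamicLimit :=
  Iff.rfl

/-! ## §2 The stub statements as named Props (their `__Registered.stub_…` aliases, §2b, are the hypotheses of the assembly) -/

/-- STUB STATEMENT (external inputs, open items VERBATIM by name): the two VELOCITY-TAIL channels along the true flow —
`TwoClocks.EnergyCurrentTails` (stmt-9235: cubic one-body tails, pre-shock, Euler-tied) and
`LimitCollisionMeasure.CollisionTightness` (stmt-13354: quartic moment tightness of the normalised collision measure under local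
Gibbs data).  Never claimed from bounded-mark chaos (the gap that sank the dock stmt-13482). -/
def VelocityTails : Prop :=
  TwoClocks.EnergyCurrentTails ∧ LimitCollisionMeasure.CollisionTightness

/-- STUB STATEMENT (external input, open item VERBATIM by name): `InformationPercolationEngine.DensityCap` (stmt-13082) — no
over-compression at the fine scale `r` before the shock.  Load-bearing for the in-band cut-offs of the Grönwall and for the
readout (neighbour NOTES §B4); not derivable from in-probability inputs with tolerances fixed before `r`. -/
def FineScaleDensityCap : Prop :=
  InformationPercolationEngine.DensityCap

/-- STUB STATEMENT (own, XL — the HARDEST, the crux's kinetic content, "EmpiricalHTheorem" of the route's two-layer plan):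
CELL MAXWELLIANISATION ⇒ IN-BAND FLUX CLOSURE.  From this route's cell/window empirical Enskog chaos `ContactChaos` (SEL+ANG+RATE,
stmt-12125), the cubic one-body tails and the UI of the quadratic collision mark: weak isotropy of the full local pressure tensor
and the hard-sphere collisional pressure value, both in band.  Intended proof: Bogolyubov's exact empirical identity in each cell
(landed vocabulary: `LimitCollisionMeasure.EmpiricalEnskogIdentity`, `Theorems.ChaosClosesEulerWeakEquation`) + SEL/ANG/RATE ⇒
the smoothed cell velocity law is, over every window of `M` kinetic units, an approximate solution of the homogeneous
Enskog–Boltzmann equation with the Enskog rate; H-theorem with Cercignani-type entropy-production bounds (DesvillettesVillani2005)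
⇒ for a.e. macroscopic `(s, x)` the local law is within `o(1)` of a Maxwellian as `M → ∞` (the statement quantifies `∀ M`), the
escaping anisotropic energy paid by the cubic tail; the collisional value by SEL+ANG on the truncated stress mark, the identity
`∫(g·ω)₊² ω⊗ω dω = (2π/15)(|g|²𝟙 + 2g⊗g)` (landed p104685), RATE's contact factor and `CollisionMomentUI` for the remainder.
Why it might fail: bounded-`F` chaos in shrinking cells may be too weak for a quantitative H-theorem on EMPIRICAL measures
(atomic measures have no entropy: smoothing at a scale between `ε` and `h`); a kinetic-scale temporal oscillation of the cell
law (neighbour NOTES §B2's two-state witness) must be excluded by the window-vs-start-time form of SEL. -/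
def CellMaxwellianisation : Prop :=
  ContactChaos → TwoClocks.EnergyCurrentTails → CollisionMomentUI →
    WeakStressIsotropyInBand ∧ CollisionalPressureValueInBand

/-- STUB STATEMENT (own, M–L): RATE TRANSFER.  The RATE clause of `ContactChaos` (ordered collision count in `B(x₀,h) × [t, t+w_N]`
within a factor `δ` of the Enskog prediction `Σ_{pairs in cell} π ε² |vᵢ − vⱼ| w_N g_E(n_cell σ³)/|cell|`, in probability, `h` fixed
before `N → ∞`) implies the cone-mollified, space–time-tested in-band rate identification
`InformationPercolationEngine.CollisionRate` (stmt-13481: `K_N[χ g(σ³ρ_r)] − σ³∫∫χ g Y(σ³ρ_r) B¹_r → 0` in probability), using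
`(2π/3)·g_E(η)·η = Z(η) − 1 = η·(3/(2π))⁻¹… ` i.e. `Y = (3/2π) f_ex′` = the same contact value (`HsEosLowDensity_holds`), a
finite net of cells at fixed `h` (finite unions of small-probability events), Fubini in `(s, z)` over the `O(w_N⁻¹)` kinetic
windows of `[0, τ]`, and the tails (`EnergyCurrentTails`, `CollisionTightness`) for the `|v − v*|`-weighted counts of the
exceptional windows.  Why it might fail: the per-`(t, x₀)` in-probability form of RATE carries no uniformity in `t`; the
time integral needs the measurability/domination to run Fubini, and the exceptional windows' collision mass is controlled only
through 13354. -/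
def RateTransfer : Prop :=
  ContactChaos → TwoClocks.EnergyCurrentTails → LimitCollisionMeasure.CollisionTightness →
    InformationPercolationEngine.CollisionRate

/-- STUB STATEMENT (own, XL, Boltzmann-hypothesis class): ENTROPY PRODUCTION ⇒ CLAMPED LOCAL SECOND LAW.  From cell/window
empirical Enskog chaos with the REVISED-Enskog contact factor (RATE: `g_E` at the empirical cell density) the Résibois H-theorem
(Resibois1978: `d/dt (S_kin + S_conf) ≥ 0`, `S_conf = −∫ρ f_ex(ρσ³)`) holds at the empirical level up to `o_P(1)`, giving the
clamped, cut-EOS local entropy inequality in probability `LimitCollisionMeasure.LocalSecondLaw` (stmt-13352) — the renormalised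
format the BF18 Grönwall consumes (neighbour NOTES §B3: the unclamped 13081 does not suffice).  Tails enter through the entropy
FLUX of fast particles.  Why it might fail: at Euler scaling the leading entropy production vanishes by local balance and the
local sign is that of the `O(Kn)` deviation; no in-probability local second law is known for deterministic spheres; the
configurational entropy current must be exactly `Z(s)m` at Euler order. -/
def EntropyProduction : Prop :=
  ContactChaos → TwoClocks.EnergyCurrentTails → LimitCollisionMeasure.CollisionTightness →
    LimitCollisionMeasure.LocalSecondLaw

/-- STUB STATEMENT (PDE half, XL−; shared in substance with the neighbouring line's open `stub_kineticReduction` + its LANDED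
deterministic shell `Theorems.ChaosClosesEulerBF18Shell.stub_bf18Shell`, minus the three LANDED pathwise inputs
`MassBalanceC1` p133127, `EmpiricalWeakEquation` p108039, `InitialLayer` p97752, which a prover cites rather than assumes):
RELATIVE-ENERGY STABILITY.  In-band weak stress isotropy + collisional pressure value + UI of the quadratic mark + in-band rate +
clamped local second law + fine-scale density cap ⇒ TIME-AVERAGED `L¹` closeness of the cone-mollified empirical fields to the
classical solution (`MollifiedCloseTimeAveraged`), by the pathwise Březina–Feireisl relative-energy Grönwall up to the first
coarse excursion time (BrezinaFeireisl2018 §3; tree: `CompressibleEuler.brezinaFeireisl2018_thm_3_3_holds`, `weakStrong_core`).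
Why it might fail: the `sup` over `τ` of the momentum residual needs a pathwise time-modulus from energy bounds and FIXED bumps;
all tolerances must be fixed before `r` (`(ε, Δ) → δ → grids → (η, δ per input) → r₀ → r → N₀`). -/
def RelativeEnergyStability : Prop :=
  WeakStressIsotropyInBand → CollisionalPressureValueInBand → CollisionMomentUI →
    InformationPercolationEngine.CollisionRate → LimitCollisionMeasure.LocalSecondLaw →
    InformationPercolationEngine.DensityCap → MollifiedCloseTimeAveraged

/-! ## §2b The stub statements BY STUB NAME — the hypotheses of `ChaosClosure_of`

The native skeleton audit (`#h21_check_skeleton`, run by `ledger skeleton check`) admits a hypothesis of the composing theorem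
only if its head constant is a registered obligation or is NAMED like a declared stub, and the `@[stub]` tag is gate-reserved;
so each statement is mirrored by the alias `abbrev __Registered.stub_X : Prop := X` and `ChaosClosure_of` is stated over the six
aliases (device of the sibling birth skeletons `Cruxes/FastCollisionThroughput/Lines/birth.lean`,
`Cruxes/MaxSpeedBoundPreShock/Lines/birth.lean`; the `__` namespace is an implementation detail, so the audit resolves each
`stub_…` to the sorried theorem of §3, not to its alias).  The `example`s after §3 check that the registered theorems, the
aliases and the named `Prop`s agree definitionally. -/
namespace __Registered

/-- Alias of `VelocityTails`, keyed by the registered name `stub_velocityTails`. -/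
abbrev stub_velocityTails : Prop := VelocityTails

/-- Alias of `FineScaleDensityCap`, keyed by the registered name `stub_densityCap`. -/
abbrev stub_densityCap : Prop := FineScaleDensityCap

/-- Alias of `CellMaxwellianisation`, keyed by the registered name `stub_cellMaxwellianisation`. -/
abbrev stub_cellMaxwellianisation : Prop := CellMaxwellianisation

/-- Alias of `RateTransfer`, keyed by the registered name `stub_rateTransfer`. -/
abbrev stub_rateTransfer : Prop := RateTransfer

/-- Alias of `EntropyProduction`, keyed by the registered name `stub_entropyProduction`. -/
abbrev stub_entropyProduction : Prop := EntropyProduction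

/-- Alias of `RelativeEnergyStability`, keyed by the registered name `stub_relativeEnergyStability`. -/
abbrev stub_relativeEnergyStability : Prop := RelativeEnergyStability

end __Registered

/-! ## §3 The registered stubs (`sorry` lives ONLY here) -/

/-- STUB (external ×2, open): body VERBATIM `VelocityTails`. -/
theorem stub_velocityTails :
    TwoClocks.EnergyCurrentTails ∧ LimitCollisionMeasure.CollisionTightness := by
  sorry

/-- STUB (external, open): body VERBATIM `FineScaleDensityCap`. -/
theorem stub_densityCap : InformationPercolationEngine.DensityCap := by
  sorry

/-- STUB (own, XL, hardest): body VERBATIM `CellMaxwellianisation`. -/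
theorem stub_cellMaxwellianisation :
    ContactChaos → TwoClocks.EnergyCurrentTails → CollisionMomentUI →
      WeakStressIsotropyInBand ∧ CollisionalPressureValueInBand := by
  sorry

/-- STUB (own, M–L): body VERBATIM `RateTransfer`. -/
theorem stub_rateTransfer :
    ContactChaos → TwoClocks.EnergyCurrentTails → LimitCollisionMeasure.CollisionTightness →
      InformationPercolationEngine.CollisionRate := by
  sorry

/-- STUB (own, XL): body VERBATIM `EntropyProduction`. -/
theorem stub_entropyProduction :
    ContactChaos → TwoClocks.EnergyCurrentTails → LimitCollisionMeasure.CollisionTightness →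
      LimitCollisionMeasure.LocalSecondLaw := by
  sorry

/-- STUB (shared-open, XL−): body VERBATIM `RelativeEnergyStability`. -/
theorem stub_relativeEnergyStability :
    WeakStressIsotropyInBand → CollisionalPressureValueInBand → CollisionMomentUI →
      InformationPercolationEngine.CollisionRate → LimitCollisionMeasure.LocalSecondLaw →
      InformationPercolationEngine.DensityCap → MollifiedCloseTimeAveraged := by
  sorry

/-- The registered theorems, the `__Registered` aliases and the named `Prop`s are the same statements. -/
example : __Registered.stub_velocityTails := stub_velocityTails
example : __Registered.stub_densityCap := stub_densityCap
example : __Registered.stub_cellMaxwellianisation := stub_cellMaxwellianisation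
example : __Registered.stub_rateTransfer := stub_rateTransfer
example : __Registered.stub_entropyProduction := stub_entropyProduction
example : __Registered.stub_relativeEnergyStability := stub_relativeEnergyStability
example : VelocityTails = __Registered.stub_velocityTails := rfl
example : FineScaleDensityCap = __Registered.stub_densityCap := rfl
example : CellMaxwellianisation = __Registered.stub_cellMaxwellianisation := rfl
example : RateTransfer = __Registered.stub_rateTransfer := rfl
example : EntropyProduction = __Registered.stub_entropyProduction := rfl
example : RelativeEnergyStability = __Registered.stub_relativeEnergyStability := rfl

/-! ## §4 The assembly (real proof, no `sorry`) -/

/-- **THE SKELETON THEOREM — the six registered stubs (by name, via their `__Registered` aliases) imply the crux BY NAME.**  `CollisionMomentUI` from `CollisionTightness` (landed Chebyshev step); at the given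
`ContactChaos` the kinetic stubs return the in-band flux closures, the in-band rate identification and the clamped local second
law; the relative-energy stub returns time-averaged `L¹` closeness; the LANDED weak readout
(`Theorems.ChaosClosesEulerReadout.stub_readout`, with the LANDED exact identity
`Theorems.ChaosClosesEulerEnskogIdentity.stub_empiricalEnskogIdentity`) returns the packing-guarded conjunct at every
`t ∈ [0, T)`, which is the crux's conclusion verbatim. -/
theorem ChaosClosure_of :
    __Registered.stub_velocityTails → __Registered.stub_densityCap → __Registered.stub_cellMaxwellianisation →
      __Registered.stub_rateTransfer → __Registered.stub_entropyProduction →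
      __Registered.stub_relativeEnergyStability → ChaosClosure := by
  intro hT hD hK hR hS hG hCC
  have hUI : CollisionMomentUI :=
    Summit.AtomisticToContinuum.HydrodynamicLimit.Theorems.ChaosClosesEulerCollisionMomentUI.stub_collisionMomentUI hT.2
  have hF : WeakStressIsotropyInBand ∧ CollisionalPressureValueInBand := hK hCC hT.1 hUI
  have hRate : InformationPercolationEngine.CollisionRate := hR hCC hT.1 hT.2
  have hLSL : LimitCollisionMeasure.LocalSecondLaw := hS hCC hT.1 hT.2
  have hAvg : MollifiedCloseTimeAveraged := hG hF.1 hF.2 hUI hRate hLSL hD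
  exact Summit.AtomisticToContinuum.HydrodynamicLimit.Theorems.ChaosClosesEulerReadout.stub_readout hAvg
    Summit.AtomisticToContinuum.HydrodynamicLimit.Theorems.ChaosClosesEulerEnskogIdentity.stub_empiricalEnskogIdentity
    hT.1 hUI hRate hD

/-- The six registered stubs fill the six hypotheses (wiring check; depends on the stubs' `sorry`, declares none). -/
example : ChaosClosure :=
  ChaosClosure_of stub_velocityTails stub_densityCap stub_cellMaxwellianisation stub_rateTransfer
    stub_entropyProduction stub_relativeEnergyStability

end Summit.AtomisticToContinuum.HydrodynamicLimit.Cruxes.ChaosClosure.Birth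

end
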